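import Summits.BirchSwinnertonDyer.BirchSwinnertonDyer.Theses.PAdicOrderV2
import Literature.NumberTheory.EllipticCurves.CanonicalPAdicHeight
import Summits.BirchSwinnertonDyer.BirchSwinnertonDyer.Theorems.PAdicOrderV2PAdicOrderThesisR2StubUBRank0

/-!
# Line `wieferich-jet` for crux `PAdicOrderThesisR2` (stmt-BirchSwinnertonDyer-0487) — crux-plan record

X := `Summit.BirchSwinnertonDyer.BirchSwinnertonDyer.Theses.PAdicOrderV2.PAdicOrderThesisR2`
(∀ E/ℚ globally minimal W, ∃ good ordinary p, ∃ newform f of W: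
 ord_T L_p(f, α_p, T) = r_an(W) ∧ ord_T L_p(f, α_p, T) = r_MW(W)).

## Verdict of the crux-plan seat: NO CONCLUDING SKELETON FOR X from this idea (dead line for X),
## but a CHECKED SECTOR SKELETON for the rank-one one-prime upper bound (this file).

Why no `PAdicOrderThesisR2_of` is registered. Kernel-checked invariant of the dead line `Sketch`
(`Lines/Sketch-dead.md` §2(c)): `X ↔ BSDgm ∧ OnePrimeComparison` (`thesis_iff_bsd_and_onePrime`,
p136391) and `X → (2 ≤ r_an → r_an ≤ r_MW)` (`stub_LB_ge2_of_thesis`, p100810); with the landed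
glue `padicOrderThesisR2_of_sandwich` (p96594) and `sandwich_tight` (p135275), EVERY composition
`⟨stubs⟩ → X` carries the BSD lower bound in analytic rank ≥ 2 (C5 below) and the one-prime upper
bound in analytic rank ≥ 2 (`OnePrimeUBHigherRank` below) — byte-for-byte the two goals at which
`Sketch` died under L5(3). The idea `wieferich-jet` supplies a mechanism for NEITHER (its card says
so: "claims NOTHING on {r_an ≥ 2}"); it mechanises exactly the sector {r_an = 1} of child C3
`PAdicOrderOnePrimeUB`. A skeleton for X from it would be `Sketch` with `stub_UB_pos` replaced by
the five stubs below plus `OnePrimeUBHigherRank` — 9 stubs > 7, with the whole difficulty of BSD in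
the re-imported `stub_LB_ge2` (shred lint + costume by §5 of the dead-line record); the triage
panel r2 (TRIAGE-r2-1/2/3) is unanimous on this disposition ("no skeleton for X from wieferich-jet
alone; home it on the rank-one sector: child C3 / stmt-0515 in its ∃p-weakening").
`thesis_of_sectors` below is the kernel-checked form of this paragraph: X from the two rank-sectors
of C3 plus C1, C2, C4, C5.

## The sector skeleton (what this line IS): `OnePrimeUBRankOne` = C3 restricted to r_an = 1

Target `OnePrimeUBRankOne`: every globally minimal elliptic W/ℚ of analytic rank 1 has a good
ordinary prime p ≥ 5 at which ord_T L_p(f, α_p, T) ≤ r_an(W) for every newform f of W.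
Composition `onePrimeUBRankOne_of` (sorry-free) from FIVE stubs:

* `stub_jetCongruence` — the LEVER (Mazur–Tate sigma jet): for p ≥ 5 good ordinary and an
  admissible point Q = (x, y), ‖ĥ_p(Q) − log_p(num x)‖ ≤ p^{−v_p(den x)}. Provable now (size M)
  from the tree's `canonicalPAdicHeight = log_p(den x) − 2 log_p σ_p(−x/y)`, `IsMazurTateSigmaPair`
  (σ_p ∈ t + (a₁/2)t² + t³ℤ_p⟦t⟧), `mazur_tate_sigma_existsUnique_holds`, `padicLog_mul_holds`;
  certified numerically 0/1674 violations (kit j022437, j022543, j022521).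
* `stub_jetVisible_of_not_heightWieferich` — the Iwasawa-log valuation on p-units (curve-free):
  ‖log_p a‖ = ‖a^{p−1} − 1‖ (p odd, p ∤ a), so "not height-Wieferich" ⇒ "jet visible". Size S+
  (the isometry `norm_padicLogSeries_eq` is in the tree; `p ∤ num x` for admissible points is the
  proved glue `not_dvd_num_of_isAdmissible`).
* `stub_heightNonWieferich` — (NW), the TRANSFERRED crux C⁺ (open; HARDEST): every non-torsion
  rational point has, at some good ordinary p ≥ 5, an admissible multiple (a/d², b/d³) with
  a^{p−1} ≢ 1 (mod p^{v_p(d²)}). Elementary Π₂ statement; per-instance decidable.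
* `stub_LB_rankOne` — r_an = 1 ⇒ 1 ≤ r_MW (Gross–Zagier–Kolyvagin; = child C4, support; supplies
  the non-torsion point the jet is applied to). Blocked on the XL fact `gross_zagier_rank_one_rat`.
* `stub_perrinRiou_rankOne` — Perrin-Riou over ℚ: for W of analytic rank 1 and p ≥ 5 good
  ordinary, an admissible rational point of non-zero canonical cyclotomic height forces
  ord_T L_p(f, α_p, T) ≤ 1 (PR87 Thm 1.3 over a Heegner field K with p split and L(E^{d_K},1) ≠ 0,
  GZK over K, restriction of the canonical K-height; in the tree: p97535
  `order_padicLFunction_le_one_of_height_ne_zero` relative to `perrinRiou_padicGrossZagier`,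
  `friedbergHoffstein_exists_heegnerField_split_twist_ne_zero`, `isCanonicalK_restrictsTo_holds`).
  True in print; formalisation size M relative to the named facts.

Disproof used (Cruxes/PAdicOrderThesisR2/Disproof.lean, cycle-1 FINAL, md5 b1ba74b1): (a)/(a′)
`unitRoot_eq_zero_of_dvd`, `not_order_le_analyticRank_of_dvd` — the witness prime is ORDINARY by
construction (`IsOrdinaryAt` in `stub_heightNonWieferich` and `stub_perrinRiou_rankOne`); (c) the
landed Negative lemma `padicOrderThesisR2_false_at_every_good_prime` (p98081, ∀p form) is not
instantiated: every statement here is ∃p; (n) honoured by the verdict above. No other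
`_false_without_` theorem exists for this crux.

Nothing in this file asserts a Theses decl: the only `sorry`s are the five `stub_*`.
-/

-- single-conjunct summit: `Summit.BirchSwinnertonDyer.BirchSwinnertonDyer.…` repeats the name by design
set_option linter.dupNamespace false

namespace Summit.BirchSwinnertonDyer.BirchSwinnertonDyer.Cruxes.PAdicOrderThesisR2.WieferichJet

open Literature.NumberTheory.EllipticCurves Literature.NumberTheory.EllipticCurves.ModularForms
open Summit.BirchSwinnertonDyer.BirchSwinnertonDyer.Theses.PAdicOrderV2

/-! ## Definitions (elementary) -/

/-- **Height-Wieferich** at `(x, p)`: `p` is a Wieferich prime to base `a = num x` AT LEVEL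
`v_p(den x)`: `a^{p-1} ≡ 1 (mod p^{v_p(den x)})` (or the degenerate `a^{p-1} = 1`). For an
admissible point `den x = d²`, `v_p(den x) = 2e ≥ 2`; for `e = 1` this is the classical Wieferich
condition `a^{p-1} ≡ 1 (mod p²)`. Pure integer arithmetic. -/
def IsHeightWieferich (p : ℕ) (x : ℚ) : Prop :=
  x.num ^ (p - 1) = 1 ∨ (padicValNat p x.den : ℤ) ≤ padicValInt p (x.num ^ (p - 1) - 1)

/-- **Jet visibility** (normed twin of `¬ IsHeightWieferich`): `p^{-v_p(den x)} < ‖log_p(num x)‖`. -/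
def IsJetVisible (p : ℕ) [Fact p.Prime] (x : ℚ) : Prop :=
  (p : ℝ) ^ (-(padicValNat p x.den : ℤ)) < ‖padicLog p ((x.num : ℚ) : ℚ_[p])‖

/-- **JET CONGRUENCE** (the lever): for `W` globally minimal, `p ≥ 5` good ordinary and an
admissible point `(x, y)`, `‖ĥ_p(x,y) − log_p(num x)‖ ≤ p^{-v_p(den x)}`. -/
def JetCongruence : Prop :=
  ∀ (W : WeierstrassCurve ℚ) [W.IsElliptic] [W.IsGloballyMinimal] (p : ℕ) [Fact p.Prime],
    5 ≤ p → IsOrdinaryAt W p →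
    ∀ {x y : ℚ} (h : W.toAffine.Nonsingular x y), W.IsAdmissible p (.some x y h) →
      ‖W.canonicalPAdicHeight p (.some x y h) - padicLog p ((x.num : ℚ) : ℚ_[p])‖
        ≤ (p : ℝ) ^ (-(padicValNat p x.den : ℤ))

/-- **Visibility criterion** (elementary, curve-free): for `p` odd and `x ∈ ℚ` with `p ∤ num x`,
not height-Wieferich ⇒ jet visible. Content: the Iwasawa logarithm is an isometry near `1`, so for
a `p`-unit integer `a`, `‖log_p a‖ = ‖(p-1)⁻¹ · L(a^{p-1})‖ = ‖a^{p-1} − 1‖ = p^{-v_p(a^{p-1} − 1)}`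
(tree: `padicLog_of_ne_zero`, `norm_padicLogSeries_eq`, PAdicHeightsLogProofs.lean). -/
def JetVisibleOfNotHeightWieferich : Prop :=
  ∀ (p : ℕ) [Fact p.Prime], p ≠ 2 → ∀ (x : ℚ), ¬ (p : ℤ) ∣ x.num →
    ¬ IsHeightWieferich p x → IsJetVisible p x

/-- **(NW) Height-non-Wieferich** — the transferred crux `C⁺`: every non-torsion rational point
has, at SOME good ordinary prime `p ≥ 5`, an admissible multiple `m • P = (a/d², b/d³)` with
`a^{p-1} ≢ 1 (mod p^{v_p(d²)})`. -/
def HeightNonWieferich : Prop :=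
  ∀ (W : WeierstrassCurve ℚ) [W.IsElliptic] [W.IsGloballyMinimal] (P : W.toAffine.Point),
    ¬ IsOfFinAddOrder P →
    ∃ (p : ℕ) (_ : Fact p.Prime), 5 ≤ p ∧ IsOrdinaryAt W p ∧
      ∃ (m : ℕ) (x y : ℚ) (h : W.toAffine.Nonsingular x y), m • P = .some x y h ∧
        W.IsAdmissible p (.some x y h) ∧ ¬ IsHeightWieferich p x

/-- **LB in analytic rank one** (Gross–Zagier 1986 + Kolyvagin 1990): `r_an = 1 ⇒ 1 ≤ r_MW`.
Byte-identical to child C4 `PAdicOrderLBRankOne` of the certified split / `Sketch.stub_LB_rank1`. -/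
def LBRankOne : Prop :=
  ∀ (W : WeierstrassCurve ℚ) [W.IsElliptic] [W.IsGloballyMinimal],
    W.analyticRank = 1 → 1 ≤ W.mordellWeilRank

/-- **Perrin-Riou over `ℚ` at one prime** (PR87 Thm 1.3 + GZK over a Heegner field with `p` split
and non-vanishing twist + restriction of the canonical `K`-height): for `W` of analytic rank `1`
and `p ≥ 5` good ordinary, an admissible rational point of non-zero canonical cyclotomic `p`-adic
height forces `ord_{T=0} L_p(f, α_p, T) ≤ 1` for every newform `f` of `W`. -/
def PerrinRiouRankOne : Prop :=
  ∀ (W : WeierstrassCurve ℚ) [W.IsElliptic] [W.IsGloballyMinimal], W.analyticRank = 1 →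
    ∀ (p : ℕ) [Fact p.Prime], 5 ≤ p → IsOrdinaryAt W p →
    ∀ {x y : ℚ} (h : W.toAffine.Nonsingular x y), W.IsAdmissible p (.some x y h) →
      W.canonicalPAdicHeight p (.some x y h) ≠ 0 →
    ∀ {N : ℕ} [NeZero N] (f : CuspForm (CongruenceSubgroup.Gamma0 N) 2), IsNewformOf W f →
      (padicLFunction f (unitRoot W p : ℚ_[p])).order ≤ 1

/-! ## Targets -/

/-- **Sector target** `C3|_{r_an = 1}`: one-prime `p`-adic upper bound in analytic rank one. -/
def OnePrimeUBRankOne : Prop :=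
  ∀ (W : WeierstrassCurve ℚ) [W.IsElliptic] [W.IsGloballyMinimal], W.analyticRank = 1 →
    ∃ (p : ℕ) (_ : Fact p.Prime), 5 ≤ p ∧ IsOrdinaryAt W p ∧
      ∀ {N : ℕ} [NeZero N] (f : CuspForm (CongruenceSubgroup.Gamma0 N) 2), IsNewformOf W f →
        (padicLFunction f (unitRoot W p : ℚ_[p])).order ≤ (W.analyticRank : ℕ∞)

/-- The complementary sector `C3|_{r_an ≥ 2}` (open; NOT addressed by this line). -/
def OnePrimeUBHigherRank : Prop :=
  ∀ (W : WeierstrassCurve ℚ) [W.IsElliptic] [W.IsGloballyMinimal], 2 ≤ W.analyticRank →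
    ∃ (p : ℕ) (_ : Fact p.Prime), 5 ≤ p ∧ IsOrdinaryAt W p ∧
      ∀ {N : ℕ} [NeZero N] (f : CuspForm (CongruenceSubgroup.Gamma0 N) 2), IsNewformOf W f →
        (padicLFunction f (unitRoot W p : ℚ_[p])).order ≤ (W.analyticRank : ℕ∞)

/-- Child C3 `PAdicOrderOnePrimeUB` of the strategist's certified split (STRATEGY-CENSUS App. A;
verbatim), = `Sketch.stub_UB_pos`. -/
def PAdicOrderOnePrimeUB : Prop :=
  ∀ (W : WeierstrassCurve ℚ) [W.IsElliptic] [W.IsGloballyMinimal], 0 < W.analyticRank →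
    ∃ (p : ℕ) (_ : Fact p.Prime), 5 ≤ p ∧ IsOrdinaryAt W p ∧
      ∀ {N : ℕ} [NeZero N] (f : CuspForm (CongruenceSubgroup.Gamma0 N) 2), IsNewformOf W f →
        (padicLFunction f (unitRoot W p : ℚ_[p])).order ≤ (W.analyticRank : ℕ∞)

/-- Child C1 (modularity, inlined body of `exists_isNewformOf`; BCDT 2001). -/
def PAdicOrderModularity : Prop :=
  ∀ (W : WeierstrassCurve ℚ) [W.IsElliptic] [NeZero (W.conductorNorm ℤ)],
    ∃ f : CuspForm (CongruenceSubgroup.Gamma0 (W.conductorNorm ℤ)) 2, IsNewformOf W f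

/-- Child C5 (BSD lower bound in analytic rank ≥ 2 — the summit's open half; the stub at which
`Sketch` died; kernel-checked NECESSARY for X, p100810). -/
def PAdicOrderLBHigherRank : Prop :=
  ∀ (W : WeierstrassCurve ℚ) [W.IsElliptic] [W.IsGloballyMinimal],
    2 ≤ W.analyticRank → W.analyticRank ≤ W.mordellWeilRank

/-! ## Registered stubs of the sector line -/

/-- Stub 1 (LEVER; provable now, size M): the jet congruence. -/
theorem stub_jetCongruence : JetCongruence := by
  sorry

/-- Stub 2 (provable now, size S+): visibility criterion via `‖log_p a‖ = ‖a^{p-1} − 1‖`. -/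
theorem stub_jetVisible_of_not_heightWieferich : JetVisibleOfNotHeightWieferich := by
  sorry

/-- Stub 3 (HARDEST; open, elementary): (NW). -/
theorem stub_heightNonWieferich : HeightNonWieferich := by
  sorry

/-- Stub 4 (= C4; GZK; blocked on `gross_zagier_rank_one_rat`): LB in analytic rank one. -/
theorem stub_LB_rankOne : LBRankOne := by
  sorry

/-- Stub 5 (in print; blocked on `perrinRiou_padicGrossZagier` + GZK-over-K + FH twist facts):
Perrin-Riou over `ℚ` at one prime. -/
theorem stub_perrinRiou_rankOne : PerrinRiouRankOne := by
  sorry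

/-! ## Proved glue -/

/-- The one-point certificate: jet congruence + jet visibility ⇒ `ĥ_p ≠ 0`. -/
theorem canonicalPAdicHeight_ne_zero_of_jet {W : WeierstrassCurve ℚ} {p : ℕ} [Fact p.Prime]
    {x y : ℚ} (h : W.toAffine.Nonsingular x y)
    (hJ : ‖W.canonicalPAdicHeight p (.some x y h) - padicLog p ((x.num : ℚ) : ℚ_[p])‖
        ≤ (p : ℝ) ^ (-(padicValNat p x.den : ℤ)))
    (hvis : IsJetVisible p x) :
    W.canonicalPAdicHeight p (.some x y h) ≠ 0 := by
  intro h0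
  rw [h0, zero_sub, norm_neg] at hJ
  exact absurd hvis (not_lt.mpr hJ)

/-- An admissible point has `p ∤ num x`: `‖x‖_p > 1` (`SatisfiesLocalConditions`) while
`p ∣ num x` would force `p ∤ den x` (coprimality) and hence `‖x‖_p ≤ 1` (`Padic.norm_rat_le_one`). -/
theorem not_dvd_num_of_isAdmissible {W : WeierstrassCurve ℚ} {p : ℕ} [Fact p.Prime] {x y : ℚ}
    (h : W.toAffine.Nonsingular x y) (hadm : W.IsAdmissible p (.some x y h)) :
    ¬ (p : ℤ) ∣ x.num := by
  intro hnum
  obtain ⟨hx, -, -⟩ : 1 < ‖((x : ℚ) : ℚ_[p])‖ ∧ _ ∧ _ := hadm.2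
  have hden : ¬ p ∣ x.den := by
    intro hden
    have h1 : p ∣ x.num.natAbs := Int.natCast_dvd.mp hnum
    have h2 : p ∣ Nat.gcd x.num.natAbs x.den := Nat.dvd_gcd h1 hden
    rw [x.reduced.gcd_eq_one] at h2
    exact (Fact.out : p.Prime).one_lt.ne' (Nat.dvd_one.mp h2)
  have hle : ‖((x : ℚ) : ℚ_[p])‖ ≤ 1 := Padic.norm_rat_le_one hden
  exact absurd hx (not_lt.mpr hle)

/-- Pure algebra: an abelian group of `ℤ`-rank `≥ 1` has an element of infinite order
(local copy of `exists_not_isOfFinAddOrder_of_one_le_finrank`, `ComplexMultiplication.lean`). -/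
theorem exists_not_isOfFinAddOrder_of_one_le_finrank' {M : Type*} [AddCommGroup M]
    (hr : 1 ≤ Module.finrank ℤ M) : ∃ x : M, ¬ IsOfFinAddOrder x := by
  have hrank : Module.rank ℤ M ≠ 0 := by
    have hr' : 0 < Module.finrank ℤ M := hr
    have hlt : ((0 : ℕ) : Cardinal) < Module.rank ℤ M := Module.lt_rank_of_lt_finrank hr'
    exact ne_of_gt (by simpa using hlt)
  have hP : ¬ ∀ x : M, ∃ a : ℤ, a ≠ 0 ∧ a • x = 0 :=
    fun hall => hrank (rank_eq_zero_iff.2 hall)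
  push Not at hP
  obtain ⟨P, hP⟩ := hP
  refine ⟨P, fun hfin => ?_⟩
  obtain ⟨n, hn, hnP⟩ := (isOfFinAddOrder_iff_nsmul_eq_zero).1 hfin
  exact hP (n : ℤ) (by exact_mod_cast hn.ne') (by rwa [natCast_zsmul])

/-- A globally minimal elliptic curve with `1 ≤ r_MW` has a rational point of infinite order
(for the group law with decidable equality on `ℚ`; `mordellWeilRank` is `finrank ℤ E(ℚ)` with the
classical instance, bridged by `convert`). -/
theorem exists_not_isOfFinAddOrder_of_one_le_mordellWeilRank (W : WeierstrassCurve ℚ)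
    (hr : 1 ≤ W.mordellWeilRank) : ∃ P : W.toAffine.Point, ¬ IsOfFinAddOrder P := by
  have hr' : 1 ≤ Module.finrank ℤ W.toAffine.Point := by
    unfold WeierstrassCurve.mordellWeilRank at hr
    convert hr
  exact exists_not_isOfFinAddOrder_of_one_le_finrank' hr'

/-- **Sector composition (sorry-free): the five stub statements ⇒ `OnePrimeUBRankOne`.**
Given `W` of analytic rank 1: a non-torsion `P` (stub 4); (NW) gives a good ordinary `p ≥ 5` and an
admissible multiple `(x, y)` of `P` that is not height-Wieferich (stub 3); `p ∤ num x`
(`not_dvd_num_of_isAdmissible`), so it is jet-visible (stub 2), and `ĥ_p(x, y) ≠ 0` by the jet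
congruence (stub 1); Perrin-Riou over `ℚ` (stub 5) gives `ord_T L_p(f, α_p, T) ≤ 1 = r_an` for
every newform `f`. -/
theorem onePrimeUBRankOne_of :
    JetCongruence → JetVisibleOfNotHeightWieferich → HeightNonWieferich → LBRankOne →
      PerrinRiouRankOne → OnePrimeUBRankOne := by
  intro hJ hV hNW hLB hPR W _ _ hr
  obtain ⟨P, hP⟩ := exists_not_isOfFinAddOrder_of_one_le_mordellWeilRank W (hLB W hr)
  obtain ⟨p, hp, h5, hO, m, x, y, h, -, hadm, hnw⟩ := hNW W P hP
  have hvis : IsJetVisible p x := hV p (by omega) x (not_dvd_num_of_isAdmissible h hadm) hnw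
  have hne : W.canonicalPAdicHeight p (.some x y h) ≠ 0 :=
    canonicalPAdicHeight_ne_zero_of_jet h (hJ W p h5 hO h hadm) hvis
  refine ⟨p, hp, h5, hO, fun f hf ↦ ?_⟩
  rw [hr, Nat.cast_one]
  exact hPR W hr p h5 hO h hadm hne f hf

/-- The sector target modulo the five registered stubs (sorries live only in `stub_*`). -/
theorem OnePrimeUBRankOne_of_stubs : OnePrimeUBRankOne :=
  onePrimeUBRankOne_of stub_jetCongruence stub_jetVisible_of_not_heightWieferich
    stub_heightNonWieferich stub_LB_rankOne stub_perrinRiou_rankOne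

/-! ## Where the sector sits: C3 and X -/

/-- C3 from its two rank-sectors (trivial case split). -/
theorem onePrimeUB_of_sectors : OnePrimeUBRankOne → OnePrimeUBHigherRank → PAdicOrderOnePrimeUB := by
  intro h1 h2 W _ _ hpos
  rcases Nat.lt_or_ge W.analyticRank 2 with hlt | hge
  · exact h1 W (by omega)
  · exact h2 W hge

/-- **Kernel-checked form of the no-skeleton verdict.** X from the rank-one sector of this line
PLUS: modularity (C1), Kato's inequality (C2 = item stmt-0491), the rank ≥ 2 one-prime upper bound
(open, no mechanism in the card), LB in rank one (C4) and the BSD lower bound in rank ≥ 2 (C5 — the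
summit's open half, the stub at which `Sketch` died). Glue = the landed
`padicOrderThesisR2_of_sandwich` (p96594). Any `PAdicOrderThesisR2_of` built on this idea has
these antecedents (tightness p135275), hence is `Sketch` + 3 stubs: not registered. -/
theorem thesis_of_sectors : PAdicOrderModularity → PAdicOrderKatoSideR2 → OnePrimeUBRankOne →
    OnePrimeUBHigherRank → LBRankOne → PAdicOrderLBHigherRank → PAdicOrderThesisR2 := by
  intro h1 h2 h3 h4 h5 h6
  exact _root_.Summit.BirchSwinnertonDyer.BirchSwinnertonDyer.Cruxes.PAdicOrderThesisR2.KatoSandwich.padicOrderThesisR2_of_sandwich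
    h1 h2 (onePrimeUB_of_sectors h3 h4) h5 h6

/-! ## The definitions compute (in-Lean special cases, no `sorry`) -/

/-- MST 2006 §4.1 instance of the lever's certificate: 37a1, `p = 5`, `Q = 8P = (21/25, -69/125)`;
`21⁴ - 1 = 5 · 38896` with `5 ∤ 38896`, so `v_5 = 1 < 2 = v_5(25)`: NOT height-Wieferich (jet
visible; by hand ĥ₅(Q) ≡ log₅ 21 ≡ 20 (mod 25), matching MST's printed `h₅(Q) = 3 + 5 + 2·5³ + ⋯`). -/
example : ¬ IsHeightWieferich 5 (21/25 : ℚ) := by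
  haveI : Fact (Nat.Prime 5) := ⟨by norm_num⟩
  have hn : (21/25 : ℚ).num = 21 := by decide +kernel
  have hd : (21/25 : ℚ).den = 25 := by decide +kernel
  have h1 : padicValNat 5 25 = 2 := by
    rw [show (25 : ℕ) = 5 ^ 2 by norm_num, padicValNat.prime_pow]
  have h2 : padicValInt 5 ((21 : ℤ) ^ (5 - 1) - 1) = 1 := by
    rw [show (21 : ℤ) ^ (5 - 1) - 1 = ((5 * 38896 : ℕ) : ℤ) by norm_num, padicValInt.of_nat,
      padicValNat.mul (by norm_num) (by norm_num), padicValNat.self (by norm_num),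
      padicValNat.eq_zero_of_not_dvd (by norm_num)]
  unfold IsHeightWieferich
  rw [hn, hd, h1, h2]
  norm_num

/-- A toy height-Wieferich instance (the predicate is not vacuous): `7⁴ - 1 = 2400 = 5² · 96`, so
`x = 7/25` IS height-Wieferich at `5` (at such a prime the rational jet is silent). -/
example : IsHeightWieferich 5 (7/25 : ℚ) := by
  haveI : Fact (Nat.Prime 5) := ⟨by norm_num⟩
  have hn : (7/25 : ℚ).num = 7 := by decide +kernel
  have hd : (7/25 : ℚ).den = 25 := by decide +kernel
  have h1 : padicValNat 5 25 = 2 := by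
    rw [show (25 : ℕ) = 5 ^ 2 by norm_num, padicValNat.prime_pow]
  have h2 : padicValInt 5 ((7 : ℤ) ^ (5 - 1) - 1) = 2 := by
    rw [show (7 : ℤ) ^ (5 - 1) - 1 = ((5 ^ 2 * 96 : ℕ) : ℤ) by norm_num, padicValInt.of_nat,
      padicValNat.mul (by norm_num) (by norm_num), padicValNat.prime_pow,
      padicValNat.eq_zero_of_not_dvd (by norm_num)]
  unfold IsHeightWieferich
  rw [hn, hd, h1, h2]
  norm_num

end Summit.BirchSwinnertonDyer.BirchSwinnertonDyer.Cruxes.PAdicOrderThesisR2.WieferichJet
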